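import Summits.RiemannHypothesis.RiemannHypothesis.Theorems.LagariasZeroFreeDoorHadamard
import Literature.Analysis.Complex.HadamardMinimumModulusProofs
import HarnessLib

/-!
# The Lagarias zero-free door, UNCONDITIONAL: `RH ⟺ E_ξ zero-free on ℂ₊` (kernel RH-equivalence, no named input left)

Cell rh-split, seat rh-split-typer-2 g4 (brief sha16 f79c5f09d8bcb036).  The door
`Theorems/LagariasZeroFreeDoor.lean` had two typed classical inputs: `StripMaxPrinciple` (discharged by dbr-neg g6,
`Theorems/LagariasZeroFreeDoorStrip.lean`, `stripMaxPrinciple_holds`) and `MinModulusCircles` (reduced by dbr-neg g6 to the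
printed Hadamard minimum-modulus theorem, `Theorems/LagariasZeroFreeDoorHadamard.lean`,
`minModulusCircles_of_hadamard : Titchmarsh1939_thm_8_711 → MinModulusCircles`).  The named fact is now a TREE THEOREM
(`Literature.Analysis.Complex.Titchmarsh1939_thm_8_711_holds`, `Literature/Analysis/Complex/HadamardMinimumModulusProofs.lean`,
typer-2 g4), so every conditional of the chain specialises to an unconditional statement:

* `minModulusCircles_holds : MinModulusCircles` — RH-FREE kernel theorem (Hadamard for `E_ξ`);
* `zeroFreeDoor_holds : ZeroFreeDoor` — RH-FREE bookkeeping: `E_ξ` zero-free on `ℂ₊` ⟹ RH;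
* `riemannHypothesis_iff_lagariasE_ne_zero : RiemannHypothesis ↔ ∀ z, 0 < Im z → E_ξ z ≠ 0` — the ZERO-FREE DOOR as a
  KERNEL RH-EQUIVALENCE with NO hypothesis (RH-EQUIVALENT, PROVED; it certifies nothing about RH);
* `norm_lagariasTheta_mul_le_one_holds`, `norm_lagariasTheta_le_one_of_zeroFree_holds` — Part D's multiplier bounds, now
  RH-FREE kernel theorems outright.

In `s = ½ − iz` coordinates the door reads: RH ⟺ `ξ(s) + ξ′(s) ≠ 0` for `Re s > 1/2` (`E_ξ(z) = ξ(½ − iz) + ξ′(½ − iz)`,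
`Literature.NumberTheory.LFunctions.lagariasE`).  Nothing here is a claim about the truth of RH.
-/

noncomputable section

-- D-0017: `Summit.<S>.<S>.…` is the designed namespace of a single-problem summit.
set_option linter.dupNamespace false

open Set Complex
open Literature.NumberTheory.LFunctions Literature.Analysis.DeBrangesSpaces Literature.Analysis.Complex
open Summit.RiemannHypothesis.RiemannHypothesis.Theorems.LagariasZeroFreeDoor
open Summit.RiemannHypothesis.RiemannHypothesis.Theorems.LagariasZeroFreeDoorStrip
open Summit.RiemannHypothesis.RiemannHypothesis.Theorems.LagariasThetaContractive
open Summit.RiemannHypothesis.RiemannHypothesis.Theorems.LagariasZeroFreeDoorHadamard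

namespace Summit.RiemannHypothesis.RiemannHypothesis.Theorems.LagariasZeroFreeDoorUnconditional

/-- RH-FREE KERNEL THEOREM (Hadamard's minimum modulus for `E_ξ`): for every `ε > 0` there are circles `|z| = r → ∞`
on which `|E_ξ(z)| ≥ exp(−r^{1+ε})` — the door's typed input `MinModulusCircles`, now PROVED
(`minModulusCircles_of_hadamard` + `Titchmarsh1939_thm_8_711_holds`). -/
theorem minModulusCircles_holds : MinModulusCircles :=
  minModulusCircles_of_hadamard Titchmarsh1939_thm_8_711_holds

/-- RH-FREE bookkeeping, now hypothesis-free: `E_ξ` zero-free on the open upper half-plane ⟹ RH (`ZeroFreeDoor`). -/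
theorem zeroFreeDoor_holds : ZeroFreeDoor :=
  zeroFreeDoor_of_minModulusCircles minModulusCircles_holds

/-- **The Lagarias zero-free door, unconditional** — a KERNEL RH-EQUIVALENCE with no named input:
`RH ⟺ E_ξ(z) ≠ 0` for all `z` with `Im z > 0` (equivalently `ξ(s) + ξ′(s) ≠ 0` for `Re s > 1/2`).  RH-EQUIVALENT, PROVED;
it certifies nothing about RH. -/
theorem riemannHypothesis_iff_lagariasE_ne_zero :
    RiemannHypothesis ↔ ∀ z : ℂ, 0 < z.im → lagariasE z ≠ 0 :=
  riemannHypothesis_iff_lagariasE_zeroFree Titchmarsh1939_thm_8_711_holds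

/-- RH-FREE KERNEL THEOREM (Part D multiplier bound, hypothesis-free): for any `b` with `|b| ≤ 1` on the closed upper
half-plane (continuous at real points) and any holomorphic extension `S` of `Θ_ξ·b` to the strip `0 < Im z < 1/2`,
`|Θ_ξ(z) b(z)| ≤ 1` at every `z ∈ ℂ₊` with `E_ξ(z) ≠ 0`. -/
theorem norm_lagariasTheta_mul_le_one_holds {b S : ℂ → ℂ}
    (hS : DiffContOnCl ℂ S (im ⁻¹' Ioo 0 (1 / 2)))
    (hSb : ∀ z : ℂ, 0 ≤ z.im → lagariasE z ≠ 0 → S z = lagariasTheta z * b z)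
    (hb : ∀ z : ℂ, 0 ≤ z.im → ‖b z‖ ≤ 1) (hbc : ∀ x : ℝ, ContinuousAt b x)
    {z : ℂ} (hz : 0 < z.im) (hE : lagariasE z ≠ 0) : ‖lagariasTheta z * b z‖ ≤ 1 :=
  norm_lagariasTheta_mul_le_one minModulusCircles_holds hS hSb hb hbc hz hE

/-- RH-FREE KERNEL THEOREM (the `b = 1` case, hypothesis-free): if `E_ξ` is zero-free on `ℂ₊` then `|Θ_ξ| ≤ 1` on `ℂ₊`. -/
theorem norm_lagariasTheta_le_one_of_zeroFree_holds (hzf : ∀ z : ℂ, 0 < z.im → lagariasE z ≠ 0) {z : ℂ}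
    (hz : 0 < z.im) : ‖lagariasTheta z‖ ≤ 1 :=
  norm_lagariasTheta_le_one_of_zeroFree minModulusCircles_holds hzf hz

end Summit.RiemannHypothesis.RiemannHypothesis.Theorems.LagariasZeroFreeDoorUnconditional

end
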